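import Summits.BirchSwinnertonDyer.BirchSwinnertonDyer.Theorems.UniversalToricDescentToricKernelAtThreeDegreeOnlyTwinOfPrint
import HarnessLib

/-!
# Route `UniversalToricDescent` — the INTEGRAL road's kernel⁵ with the twin's ANALYTIC `μ = 0` in RK-7's T-SHAPE
# (part 1/2: squeeze + pointwise kernel): KERNEL CONFIRMATION that `TwinMuZeroAtThreeT` suffices for kernel⁵ 22543 (hK′)

Width prover `bsd-wall-utd-p1-w2` g7 under LEAD `bsd-wall-utd-p1` g20 (`--supports stmt-BirchSwinnertonDyer-20400`). Companion of
`…KernelRationalRoadOddTMuPointwise` / `…OddTMuOfR2` (the rational road's hKr′). The `closes` binder hK =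
`ToricKernelAtThreeApZeroOddDegreeOfPrint` (22543, ✓ p640116) takes `TwinMuZeroAtThree` (20400) by name; the pen's RK-7 (memo
`Cruxes/ToricTransportModThree/PEN-MEMO-RK7-v1.md`, item 4) keys its successor hK′ with the T-restriction `TwinMuZeroAtThreeT`
instead. READING — kernel⁵ uses `TwinMuZeroAtThree` ONCE (`…DegreeOnlyTwinSqueeze` §1, l.147: the norm-one coefficient of the twin's
degree frame), at its Friedberg–Hoffstein field (`d_K` odd) and at the handed twin (bucket known to the trichotomy) — so the T-shape
costs nothing. Part 1 (here): §1″ `charIdeal_eq_of_defectPT_of_wall_of_frameMu_degreeConditional` (p639548 §1, frame-local `μ`)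
and §2″ `bsdp_three_of_twinDegreeFrameAt_odd_of_defectPT_tMu` (p639548 §2, pointwise `hmu'`). Part 2
(`…KernelDegreeOnlyTwinTMuOfPrint`): trichotomy / package / `kernelDeg_of_tText` = 22543's text with `TwinMuZeroAtThree ↦ T-text`.

THEOREMS ONLY; no definition, no named fact, no `sorry`. HONEST FRAMING: implications between route items and displayed hypotheses;
BSD is proved for no curve by this file; 23042 / 20395 / 20400 stay OPEN. References: [GreenbergVatsal2000] Thm. (1.4), Prop. (2.8);
[JetchevSkinnerWan2017] §7.4.1; [FriedbergHoffstein1995] Thm. B.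
-/

noncomputable section

open scoped Classical

set_option linter.dupNamespace false
set_option autoImplicit false

namespace Summit.BirchSwinnertonDyer.BirchSwinnertonDyer.Theorems.UniversalToricDescentKernelDegreeOnlyTwinT

open WeierstrassCurve NumberField IsDedekindDomain Field
  Literature.NumberTheory.EllipticCurves
  Literature.NumberTheory.EllipticCurves.ModularForms
  Literature.NumberTheory.EllipticCurves.Rank1Residual
  Literature.NumberTheory.EllipticCurves.KrizLi2019
  Literature.NumberTheory.EllipticCurves.LiuZhangZhang2018
  Summit.BirchSwinnertonDyer.Rank1Residual
  Summit.BirchSwinnertonDyer.Rank1Residual.Additive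
  Summit.BirchSwinnertonDyer.Rank1Residual.X11b
  Summit.BirchSwinnertonDyer.Rank1Residual.X11b.AcSelmer
  Summit.BirchSwinnertonDyer.Rank1Residual.X11b.Halves
  Summit.BirchSwinnertonDyer.BirchSwinnertonDyer.Theses.UniversalToricDescent
  Summit.BirchSwinnertonDyer.BirchSwinnertonDyer.Theorems
  Summit.BirchSwinnertonDyer.BirchSwinnertonDyer.Theorems.UniversalToricDescentTwinChoice
  Summit.BirchSwinnertonDyer.BirchSwinnertonDyer.Theorems.UniversalToricDescentWaldspurgerFlat
  Summit.BirchSwinnertonDyer.BirchSwinnertonDyer.Theorems.UniversalToricDescentKernelOdd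
  Summit.BirchSwinnertonDyer.BirchSwinnertonDyer.Theorems.UniversalToricDescentKernelOfPrint
  Summit.BirchSwinnertonDyer.BirchSwinnertonDyer.Theorems.UniversalToricDescentKernelFlatOfPrint
  Summit.BirchSwinnertonDyer.BirchSwinnertonDyer.Theorems.UniversalToricDescentActDFlatGlue
  Summit.BirchSwinnertonDyer.BirchSwinnertonDyer.Theorems.UniversalToricDescentNormProfile
  Summit.BirchSwinnertonDyer.BirchSwinnertonDyer.Theorems.UniversalToricDescentDefectTransport
  Summit.BirchSwinnertonDyer.BirchSwinnertonDyer.Theorems.UniversalToricDescentDefectPTSqueeze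
  Summit.BirchSwinnertonDyer.BirchSwinnertonDyer.Theorems.UniversalToricDescentKernelDefectPTOfPrint
  Summit.BirchSwinnertonDyer.BirchSwinnertonDyer.Theorems.UniversalToricDescentKernelDefectPTTROfPrint
  Summit.BirchSwinnertonDyer.BirchSwinnertonDyer.Theorems.UniversalToricDescentKernelDegreeOnlyTwin
  Summit.BirchSwinnertonDyer.BirchSwinnertonDyer.Theorems.UniversalToricDescentKernelDegreeOnlyTwinOfPrint

section Squeeze

variable (W : WeierstrassCurve ℚ) [W.IsElliptic] [W.IsGloballyMinimal] (W' : WeierstrassCurve ℚ) [W'.IsElliptic]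
  [W'.IsGloballyMinimal] (N N' : ℕ) [NeZero N] [NeZero N'] (K : Type) [Field K] [NumberField K]
  (Dt : ModularParametrizationData W N) (Dt' : ModularParametrizationData W' N')

/-! ### §1″ The squeeze on ♭T≤ → wall, DEGREE-conditional twin clause, frame-local analytic μ -/

/-- **The cross-squeeze of the INTEGRAL road (♭T≤ `DefectTransportModThreePT` 23042 → wall 20395), DEGREE currency, twin
ANALYTIC `μ` asked only AT THE TWIN'S OWN FRAMES** = `…KernelDegreeOnlyTwin.charIdeal_eq_of_defectPT_of_wall_of_mu_degreeConditional`
(utd-p2-w2 g6, p639548 §1) VERBATIM except for its ONLY use of the by-name binder `TwinMuZeroAtThree` (the norm-one coefficient of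
the twin's degree frame `L′`), replaced by the frame-local displayed hypothesis `hmuW'` — the shape RK-7's `TwinMuZeroAtThreeT`
supplies once `d_K` is odd and the bucket of `W′` is known. CONDITIONAL on every displayed hypothesis; BSD is proved for no curve
by this. [cite: GreenbergVatsal2000, Thm. (1.4)] [cite: JetchevSkinnerWan2017, §7.4.1] -/
theorem charIdeal_eq_of_defectPT_of_wall_of_frameMu_degreeConditional (hD : DefectTransportModThreePT)
    (hwall : AdditiveSplitIMCInclusionAtThree)
    (hPT : PoitouTateSelmerStructureDualityFact) (hPT2 : PoitouTateShaTateDualFact)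
    (hO6 : Additive.ClassO6 W 3) (hsurj : W.HasSurjectiveModNGaloisRep 3) (hr : W.analyticRank = 1)
    (hN : W.conductorNorm ℤ = N) (hcong : O6.ModPCongruent W' W 3) (hss : ¬ Addv W' 3) (hN' : W'.conductorNorm ℤ = N')
    (hK : IsImaginaryQuadratic K) (hHN : SatisfiesHeegnerHypothesis N K) (hHN' : SatisfiesHeegnerHypothesis N' K)
    (hfinE : ∀ (v : HeightOneSpectrum (𝓞 K)), ((3 : ℕ) : 𝓞 K) ∈ v.asIdeal → Finite (selmerAcBase (W.baseChange K) 3 v ∅))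
    (κ : ZpExtension K 3) (hκ : κ.IsAnticyclotomic) (γ : absoluteGaloisGroup K) [Fact (κ.IsTopGenerator γ)]
    (𝔭 : HeightOneSpectrum (𝓞 K)) (h𝔭 : ((3 : ℕ) : 𝓞 K) ∈ 𝔭.asIdeal) (he : 𝔭.asIdeal.ramificationIdx (𝓞 ℚ) = 1)
    (hf : 𝔭.asIdeal.inertiaDeg (𝓞 ℚ) = 1) (𝔭' : HeightOneSpectrum (𝓞 K)) (h𝔭' : ((3 : ℕ) : 𝓞 K) ∈ 𝔭'.asIdeal)
    (hne : 𝔭' ≠ 𝔭) (ι' : PadicAlgCl 3 ≃+* ℂ) (hind : SchneiderFree.BranchInducesPrime 3 ι' 𝔭)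
    (hmuW' : ∀ (ΩK' : ℂ) (Ωp' : ℂ_[3]) (L' : UnrSeries 3), ΩK' ≠ 0 → Ωp' ≠ 0 → IsBDPLFunction ι' 𝔭 κ γ Dt'.f ΩK' Ωp' L' →
      ∃ i : ℕ, ‖((PowerSeries.coeff i L' : unrIntegers 3) : ℂ_[3])‖ = 1)
    (htors : Module.IsTorsion (IwasawaAlgebra 3) (XAc (W.baseChange K) 3 κ 𝔭' ∅ γ))
    (hdeg : ∃ (ΩK' : ℂ) (Ωp' : ℂ_[3]) (L' : UnrSeries 3), ΩK' ≠ 0 ∧ Ωp' ≠ 0 ∧ IsBDPLFunction ι' 𝔭 κ γ Dt'.f ΩK' Ωp' L' ∧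
      (Module.IsTorsion (IwasawaAlgebra 3) (XAc (W'.baseChange K) 3 κ 𝔭' ∅ γ) →
        ∀ (g : UnrSeries 3) (n m : ℕ),
          (XAc.charIdeal (W'.baseChange K) 3 κ 𝔭' ∅ γ).map (PowerSeries.map (toUnr 3)) = Ideal.span {g} →
          (∀ i < n, ‖((PowerSeries.coeff i g : unrIntegers 3) : ℂ_[3])‖ < 1) ∧
              ‖((PowerSeries.coeff n g : unrIntegers 3) : ℂ_[3])‖ = 1 →
          (∀ i < m, ‖((PowerSeries.coeff i L' : unrIntegers 3) : ℂ_[3])‖ < 1) ∧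
              ‖((PowerSeries.coeff m L' : unrIntegers 3) : ℂ_[3])‖ = 1 →
          m ≤ n))
    {ΩK : ℂ} {Ωp : ℂ_[3]} {L : UnrSeries 3} (hΩK : ΩK ≠ 0) (hΩp : Ωp ≠ 0)
    (hBDP : IsBDPLFunction ι' 𝔭 κ γ Dt.f ΩK Ωp L) :
    (XAc.charIdeal (W.baseChange K) 3 κ 𝔭' ∅ γ).map (PowerSeries.map (toUnr 3)) = Ideal.span {L} := by
  -- VERBATIM p639548 §1; the ONE change: `hi'` comes from the frame-local `hmuW'` instead of `TwinMuZeroAtThree`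
  have hle : Ideal.span {L} ≤ (XAc.charIdeal (W.baseChange K) 3 κ 𝔭' ∅ γ).map (PowerSeries.map (toUnr 3)) :=
    hwall W N K Dt hO6 hsurj hr hN hK hHN κ hκ γ 𝔭 h𝔭 he hf 𝔭' h𝔭' hne ι' hind ΩK Ωp L hΩK hΩp hBDP
  obtain ⟨ΩK', Ωp', L', hΩK', hΩp', hBDP', hdegT⟩ := hdeg
  have hi' : ∃ i : ℕ, ‖((PowerSeries.coeff i L' : unrIntegers 3) : ℂ_[3])‖ = 1 := hmuW' ΩK' Ωp' L' hΩK' hΩp' hBDP'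
  obtain ⟨g, g', n, m, n', m', hIE, hI', hg, hL, hg', hL', hsum⟩ :=
    hD hPT hPT2 W W' N N' K Dt Dt' hO6 hsurj hr hN hcong hss hN' hK hHN hHN' hfinE κ hκ γ 𝔭 𝔭' h𝔭 he hf h𝔭' hne ι'
      hind htors ΩK Ωp L hΩK hΩp hBDP hle ΩK' Ωp' L' hΩK' hΩp' hBDP' hi'
  have htors' : Module.IsTorsion (IwasawaAlgebra 3) (XAc (W'.baseChange K) 3 κ 𝔭' ∅ γ) :=
    (defectTransport_torsionMu_of_wall W W' K hN hcong hN' hK hHN hHN' κ hκ γ h𝔭' htors hle ⟨m, hL.2⟩).2.2.1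
  have hgL : g ∣ L := by
    rw [hIE] at hle
    exact Ideal.mem_span_singleton.mp (hle (Ideal.mem_span_singleton_self L))
  have h₁ : n ≤ m := firstUnitCoeff_le_of_dvd hgL hg.1 hL.2
  -- CHANGED: `h₂` is the degree clause itself, evaluated at ♭T′'s generator and indices
  have h₂ : m' ≤ n' := hdegT htors' g' n' m' hI' hg' hL'
  have hnm : n = m := by omega
  subst hnm
  exact eq_span_of_span_le_of_normProfile hIE hle hg.1 hL.2

end Squeeze

/-! ### §2″ The pointwise kernel of the integral road, analytic μ pointwise (T-shape) -/

/-- **Pointwise kernel of the INTEGRAL road, DEGREE-conditional twin, twin analytic `μ = 0` POINTWISE** =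
`…KernelDegreeOnlyTwin.bsdp_three_of_twinDegreeFrameAt_odd_of_defectPT` (p639548 §2) VERBATIM except that the by-name binder
`TwinMuZeroAtThree` (stmt-…-20400) is replaced by the displayed POINTWISE hypothesis `hmu'`: for the handed pair `(W, W′)`, at every
level/field/branch datum with `d_K` ODD, every frame of `f_{W′}` has a norm-one coefficient — the text of RK-7's `TwinMuZeroAtThreeT`
with the curve binders fixed and the bucket guard removed. Costs nothing: the kernel instantiates `hmu'` only at its
Friedberg–Hoffstein field (`d_K` odd) with `Dt` in hand, through §1″. CONDITIONAL on every displayed hypothesis; BSD is proved for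
no curve by this. [cite: JetchevSkinnerWan2017, §7.4.1] [cite: FriedbergHoffstein1995, Thm. B] [cite: GreenbergVatsal2000, Thm. (1.4)] -/
theorem bsdp_three_of_twinDegreeFrameAt_odd_of_defectPT_tMu (hF : ToricPublishedInputs)
    (hD : DefectTransportModThreePT) (hwall : AdditiveSplitIMCInclusionAtThree)
    (hPT : PoitouTateSelmerStructureDualityFact) (hPT2 : PoitouTateShaTateDualFact)
    (hV : ∀ (W : WeierstrassCurve ℚ) [W.IsElliptic] [W.IsGloballyMinimal] (N : ℕ) [NeZero N] (K : Type)
      [Field K] [NumberField K] (Dt : ModularParametrizationData W N) (H : HeegnerDatum N (NumberField.discr K))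
      (ι : K →+* ℂ) (P : (W.baseChange K).toAffine.Point),
      Additive.ClassO6 W 3 → W.HasSurjectiveModNGaloisRep 3 → W.analyticRank = 1 → W.conductorNorm ℤ = N →
      IsImaginaryQuadratic K → SatisfiesHeegnerHypothesis N K → Odd (NumberField.discr K) →
      (W.quadraticTwist (NumberField.discr K : ℚ)).entireLFunction 1 ≠ 0 →
      (WeierstrassCurve.Affine.Point.map ι.toRatAlgHom) P = heegnerPointComplex Dt H → ¬ IsOfFinAddOrder P →
      ∀ (κ : ZpExtension K 3), κ.IsAnticyclotomic → ∀ (γ : absoluteGaloisGroup K) [Fact (κ.IsTopGenerator γ)]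
        (𝔭 : HeightOneSpectrum (𝓞 K)) (h𝔭 : ((3 : ℕ) : 𝓞 K) ∈ 𝔭.asIdeal)
        (he : 𝔭.asIdeal.ramificationIdx (𝓞 ℚ) = 1) (hf : 𝔭.asIdeal.inertiaDeg (𝓞 ℚ) = 1),
        ∃ ι' : PadicAlgCl 3 ≃+* ℂ, SchneiderFree.BranchInducesPrime 3 ι' 𝔭 ∧
          ∃ (ΩK : ℂ) (Ωp : ℂ_[3]) (L : UnrSeries 3), ΩK ≠ 0 ∧ Ωp ≠ 0 ∧ IsBDPLFunction ι' 𝔭 κ γ Dt.f ΩK Ωp L ∧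
            ∃ u : (unrIntegers 3)ˣ, L.HasValueAt 0 ((((u : unrIntegers 3) : unrIntegers 3) : ℂ_[3]) *
              (algebraMap ℚ_[3] ℂ_[3] (logOmega W 3 (embAt K 3 𝔭 h𝔭 he hf) P / (Dt.c : ℚ_[3]))) ^ 2))
    (hC : WildSplitControlAtThree) (hZ : WildRankZeroTwistAtThree)
    (W : WeierstrassCurve ℚ) [W.IsElliptic] [W.IsGloballyMinimal]
    (hO6 : Additive.ClassO6 W 3) (hr : W.analyticRank = 1) (hsurj : W.HasSurjectiveModNGaloisRep 3)
    (W' : WeierstrassCurve ℚ) [W'.IsElliptic] [W'.IsGloballyMinimal]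
    (hcong : O6.ModPCongruent W' W 3) (hW'ss : ¬ Addv W' 3)
    (hmu' : ∀ (N N' : ℕ) [NeZero N] [NeZero N'] (K : Type) [Field K] [NumberField K]
      (Dt : ModularParametrizationData W N) (Dt' : ModularParametrizationData W' N'),
      W.conductorNorm ℤ = N → W'.conductorNorm ℤ = N' → IsImaginaryQuadratic K → SatisfiesHeegnerHypothesis N K →
      SatisfiesHeegnerHypothesis N' K → Odd (NumberField.discr K) → ∀ (κ : ZpExtension K 3), κ.IsAnticyclotomic →
      ∀ (γ : absoluteGaloisGroup K) [Fact (κ.IsTopGenerator γ)] (𝔭 : HeightOneSpectrum (𝓞 K)),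
        ((3 : ℕ) : 𝓞 K) ∈ 𝔭.asIdeal → 𝔭.asIdeal.ramificationIdx (𝓞 ℚ) = 1 →
        𝔭.asIdeal.inertiaDeg (𝓞 ℚ) = 1 →
      ∀ (𝔭' : HeightOneSpectrum (𝓞 K)), ((3 : ℕ) : 𝓞 K) ∈ 𝔭'.asIdeal → 𝔭' ≠ 𝔭 →
      ∀ (ι' : PadicAlgCl 3 ≃+* ℂ), SchneiderFree.BranchInducesPrime 3 ι' 𝔭 →
      ∀ (ΩK : ℂ) (Ωp : ℂ_[3]) (L' : UnrSeries 3), ΩK ≠ 0 → Ωp ≠ 0 → IsBDPLFunction ι' 𝔭 κ γ Dt'.f ΩK Ωp L' →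
        ∃ i : ℕ, ‖((PowerSeries.coeff i L' : unrIntegers 3) : ℂ_[3])‖ = 1)
    (hI' : ∀ (N' : ℕ) [NeZero N'] (K : Type) [Field K] [NumberField K]
      (Dt' : ModularParametrizationData W' N'), W'.conductorNorm ℤ = N' → IsImaginaryQuadratic K →
      SatisfiesHeegnerHypothesis N' K → Odd (NumberField.discr K) →
      ∀ (κ : ZpExtension K 3), κ.IsAnticyclotomic →
      ∀ (γ : absoluteGaloisGroup K) [Fact (κ.IsTopGenerator γ)] (𝔭 : HeightOneSpectrum (𝓞 K)),
        ((3 : ℕ) : 𝓞 K) ∈ 𝔭.asIdeal → 𝔭.asIdeal.ramificationIdx (𝓞 ℚ) = 1 →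
        𝔭.asIdeal.inertiaDeg (𝓞 ℚ) = 1 →
      ∀ (𝔭' : HeightOneSpectrum (𝓞 K)), ((3 : ℕ) : 𝓞 K) ∈ 𝔭'.asIdeal → 𝔭' ≠ 𝔭 →
      ∀ (ι' : PadicAlgCl 3 ≃+* ℂ), SchneiderFree.BranchInducesPrime 3 ι' 𝔭 →
        ∃ (ΩK : ℂ) (Ωp : ℂ_[3]) (L' : UnrSeries 3), ΩK ≠ 0 ∧ Ωp ≠ 0 ∧
          IsBDPLFunction ι' 𝔭 κ γ Dt'.f ΩK Ωp L' ∧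
          (Module.IsTorsion (IwasawaAlgebra 3) (XAc (W'.baseChange K) 3 κ 𝔭' ∅ γ) →
            ∀ (g : UnrSeries 3) (n m : ℕ),
              (XAc.charIdeal (W'.baseChange K) 3 κ 𝔭' ∅ γ).map (PowerSeries.map (toUnr 3)) = Ideal.span {g} →
              (∀ i < n, ‖((PowerSeries.coeff i g : unrIntegers 3) : ℂ_[3])‖ < 1) ∧
                  ‖((PowerSeries.coeff n g : unrIntegers 3) : ℂ_[3])‖ = 1 →
              (∀ i < m, ‖((PowerSeries.coeff i L' : unrIntegers 3) : ℂ_[3])‖ < 1) ∧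
                  ‖((PowerSeries.coeff m L' : unrIntegers 3) : ℂ_[3])‖ = 1 →
              m ≤ n)) :
    BSDp W 3 := by
  -- VERBATIM p639548 §2; the ONE change: `heq` comes from §1″ fed by `hmu'` at the FH field (`hodd` in hand)
  obtain ⟨hGZ, hKo, hGZK, hmod, hmodP, -, hGZ73, hFH, hpar, hHP⟩ := hF
  haveI hN0 : NeZero (W.conductorNorm ℤ) := ⟨W.conductorNorm_pos_holds.ne'⟩
  haveI hN0' : NeZero (W'.conductorNorm ℤ) := ⟨W'.conductorNorm_pos_holds.ne'⟩
  have hw : W.rootNumber = -1 := by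
    rcases W.rootNumber_eq_one_or with h | h
    · exfalso
      have heven : Even W.analyticRank := (hpar W).mpr h
      rw [hr] at heven
      exact Nat.not_even_one heven
    · exact h
  obtain ⟨K, _, _, hK, -, hHN, hH2N', hLt⟩ :=
    hFH W hw (2 * W'.conductorNorm ℤ) (mul_ne_zero two_ne_zero hN0'.out) 0
  have hHN' : SatisfiesHeegnerHypothesis (W'.conductorNorm ℤ) K :=
    SatisfiesHeegnerHypothesis.of_dvd (dvd_mul_left _ 2) hH2N'
  have hodd : Odd (NumberField.discr K) := by
    have h8 := Literature.SatisfiesHeegnerHypothesis.discr_emod_eight hK.1 hH2N' (dvd_mul_right 2 _)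
    rw [Int.odd_iff]; omega
  have h3N : 3 ∣ W.conductorNorm ℤ :=
    (W.dvd_conductorNorm_iff_not_hasGoodReductionAtPrime 3).mpr (not_good_of_addv W 3 hO6.2.1)
  have hsplit : SplitsIn K 3 := hHN 3 Nat.prime_three h3N
  obtain ⟨P, Dt, H, ι, hP⟩ := hHP W K hK hHN
  have hL0 : W.entireLFunction 1 = 0 := entireLFunction_one_eq_zero_of_analyticRank_eq_one hr
  obtain ⟨-, hderiv⟩ := leadingLCoeff_eq_deriv_of_analyticRank_eq_one hr
  have hLK : LDerivEK W K ≠ 0 := by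
    rw [lDerivEK_eq_deriv_mul W K hmod hL0]; exact mul_ne_zero hderiv hLt
  have hnt : ¬ IsOfFinAddOrder P :=
    (lDerivEK_ne_zero_iff_not_isOfFinAddOrder W (W.conductorNorm ℤ) K (hGZ _ W K) hK hHN
      ⟨Dt, H, ι, hP⟩).mp hLK
  obtain ⟨hrk, hfin⟩ := hKo (W.conductorNorm ℤ) W K hK hHN ⟨Dt, H, ι, hP⟩ hnt
  obtain ⟨Dt'⟩ := hmodP W'
  obtain ⟨κ, γ, -, hκ, hγ, -⟩ := X11b.exists_anticyclotomic_generator_prime (p := 3) hK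
  haveI : Fact (κ.IsTopGenerator γ) := ⟨hγ⟩
  obtain ⟨𝔭, h𝔭, he, hf⟩ := X11b.exists_degreeOnePrime_of_splitsIn K 3 hK.1 hsplit
  obtain ⟨𝔭', hne, h𝔭', he', hf'⟩ := X11b.Three.exists_ne_degreeOne_prime hK.1 h𝔭 he hf
  obtain ⟨ι', hind, ΩK, Ωp, L, hΩK, hΩp, hBDP, u, hval⟩ :=
    hV W (W.conductorNorm ℤ) K Dt H ι P hO6 hsurj hr rfl hK hHN hodd hLt hP hnt κ hκ γ 𝔭 h𝔭 he hf
  -- «deg»: the twin's frame with its TORSION-CONDITIONAL DEGREE clause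
  have hdeg' := hI' (W'.conductorNorm ℤ) K Dt' rfl hK hHN' hodd κ hκ γ 𝔭 h𝔭 he hf 𝔭' h𝔭' hne ι' hind
  have hctl : SchneiderFree.AdditiveControlOnTreeAt 3 κ 𝔭' γ (embAt K 3 𝔭' h𝔭' he' hf') P :=
    hC W (W.conductorNorm ℤ) K Dt H ι P hO6 hsurj hr rfl hK hHN hLt hP hnt (hKo _ W K) κ hκ γ 𝔭'
      h𝔭' he' hf'
  obtain ⟨n, hn, hneq⟩ := hctl
  -- «act E»: the wild curve's base finiteness at every `v ∋ 3`, from rank-one data over `K`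
  have hfinE : ∀ (v : HeightOneSpectrum (𝓞 K)), ((3 : ℕ) : 𝓞 K) ∈ v.asIdeal →
      Finite (selmerAcBase (W.baseChange K) 3 v ∅) := by
    intro v hv
    haveI : Finite (W.baseChange K).sha := hfin
    have hSha3 : Finite (AddCommGroup.primaryComponent (W.baseChange K).sha 3) := inferInstance
    obtain ⟨he'', hf''⟩ := X11b.degreeOne_of_splitsIn hK.1 hsplit hv
    obtain ⟨hfinv, -⟩ :=
      SchneiderFreeAdditiveX3.natCard_selmerAcBase_mul_eq_of_rankOne_anyTorsion_shaPrimary W 3 K (hPT K)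
        (localEulerPoincareCharacteristicFact_proof K) hK hsplit hrk hSha3 P hnt v hv he'' hf''
    exact hfinv
  -- «deg»: ♭T′ → wall → μ squeeze in the DEGREE currency (§1): IMC EQUALITY for `E` at `L`
  have heq : (XAc.charIdeal (W.baseChange K) 3 κ 𝔭' ∅ γ).map (PowerSeries.map (toUnr 3)) =
      Ideal.span {L} :=
    charIdeal_eq_of_defectPT_of_wall_of_frameMu_degreeConditional W W' (W.conductorNorm ℤ) (W'.conductorNorm ℤ) K Dt Dt'
      hD hwall hPT hPT2 hO6 hsurj hr rfl hcong hW'ss rfl hK hHN hHN' hfinE κ hκ γ 𝔭 h𝔭 he hf 𝔭' h𝔭' hne ι' hind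
      (hmu' (W.conductorNorm ℤ) (W'.conductorNorm ℤ) K Dt Dt' rfl rfl hK hHN hHN' hodd κ hκ γ 𝔭 h𝔭 he hf 𝔭' h𝔭' hne ι' hind)
      hn.1 hdeg' hΩK hΩp hBDP
  have hval' : L.HasValueAt 0 ((((u : unrIntegers 3) : unrIntegers 3) : ℂ_[3]) *
      (algebraMap ℚ_[3] ℂ_[3]
        (logOmega W 3 (embAt K 3 𝔭' h𝔭' he' hf') P / (Dt.c : ℚ_[3]))) ^ 2) :=
    (SchneiderFreeAdditiveX3.hasValueAt_sq_logOmega_embAt_iff_of_rank_one W 3 hK.1 hrk h𝔭 he hf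
      h𝔭' he' hf' P _ _ L).mpr hval
  have hc0 : Dt.c ≠ 0 := Dt.maninConstant_ne_zero_holds
  have hlog : logOmega W 3 (embAt K 3 𝔭' h𝔭' he' hf') P ≠ 0 := X11b.R1.logOmega_ne_zero W 3 _ hnt
  have hlow : SchneiderFree.AdditiveIMCLowerBDPOnTreeLeAt 3 κ 𝔭' γ (embAt K 3 𝔭' h𝔭' he' hf')
      (padicValNat 3 Dt.c.natAbs) P := by
    obtain ⟨htors, f, hfI, hf0, hfn⟩ := hn
    have hmem : PowerSeries.map (toUnr 3) f ∈ Ideal.span {L} := by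
      have h3 := heq.le
      rw [hfI, CongruenceLimit.map_span_singleton_powerSeries] at h3
      exact (Ideal.span_singleton_le_iff_mem _).mp h3
    obtain ⟨-, hle⟩ := Supersingular.two_mul_valuation_le_of_mem_span 3 hf0 hmem u hval'
    have hc0' : (Dt.c : ℚ_[3]) ≠ 0 := by exact_mod_cast hc0
    rw [div_eq_mul_inv, Padic.valuation_mul hlog (inv_ne_zero hc0'), Padic.valuation_inv,
      Padic.valuation_intCast, valuation_logOmega hlog, hfn] at hle
    refine ⟨n, ⟨htors, f, hfI, hf0, hfn⟩, ?_⟩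
    simp only [padicValInt] at hle
    linarith
  have hup : SchneiderFree.Upper.AdditiveIMCUpperBDPOnTreeLeAt 3 κ 𝔭' γ (embAt K 3 𝔭' h𝔭' he' hf')
      (padicValNat 3 Dt.c.natAbs) P :=
    SchneiderFree.Upper.additiveIMCUpperBDPOnTreeLeAt_of_value_of_dvd' hn heq.ge u hc0 hlog hval'
  have hlo : SchneiderFree.IndexLowerBoundLeAt W 3 K P (padicValNat 3 Dt.c.natAbs) :=
    SchneiderFreeAdditiveX3.indexLowerBoundLeAt_of_imcLowerLe_of_control rfl hK hHN hfin hlow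
      ⟨n, hn, hneq⟩
  have hupI : SchneiderFree.Upper.IndexUpperBoundLeAt W 3 K P (padicValNat 3 Dt.c.natAbs) :=
    SchneiderFree.Upper.indexUpperBoundLeAt_of_imcUpperLe_of_control rfl hK hHN hfin hup ⟨n, hn, hneq⟩
  have hD0 : (NumberField.discr K : ℚ) ≠ 0 := by exact_mod_cast NumberField.discr_ne_zero K
  haveI : (W.quadraticTwist (NumberField.discr K : ℚ)).IsElliptic := W.isElliptic_quadraticTwist hD0
  obtain ⟨Cd, hCd⟩ := hasGlobalMinimalModel_rat_holds (W.quadraticTwist (NumberField.discr K : ℚ))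
  haveI : (Cd • W.quadraticTwist (NumberField.discr K : ℚ)).IsGloballyMinimal := hCd
  exact SchneiderFree.Exact.bsdp_three_of_exactIndexManin_of_wAllExclAddWildRankZero hGZ hKo hGZK hmod
    hGZ73 hZ W hO6 hsurj hr (W.conductorNorm ℤ) K Dt H ι P
    (Cd • W.quadraticTwist (NumberField.discr K : ℚ)) rfl hK hodd hHN hLt hP ⟨Cd, rfl⟩ hlo hupI

end Summit.BirchSwinnertonDyer.BirchSwinnertonDyer.Theorems.UniversalToricDescentKernelDegreeOnlyTwinT

end
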